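import Literature.AlgebraicGeometry.Resolution.InseparableLocalUniformizationHeightInduction
import Literature.AlgebraicGeometry.Resolution.InseparableLocalUniformizationHeightStepTwoTower
import Literature.AlgebraicGeometry.Resolution.InseparableLocalUniformizationDefectStepTower
import HarnessLib

/-!
# Inseparable local uniformization, §4.2: the induction on the height, re-threaded through the corrected Steps 3–4

Topic: `Literature/AlgebraicGeometry/Resolution`. M. Temkin, *Inseparable local uniformization*,
J. Algebra 373 (2013) 65–119 = arXiv:0804.1554v3, §4.2 "Induction on height" (pp. 50–51;
pp. 30–31 of the 41-pp. arXiv version held in the literature store).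

`InseparableLocalUniformizationHeightInduction.lean` PROVES §4.2 (Steps 0–2) from its printed
inputs and assembles `Temkin2013HeightStepOfDescent.of_lemma332nft_steps34 :
Temkin2013_Lemma332_nft → Temkin2013_Steps34 → Temkin2013HeightStepOfDescent`. The named fact
`Temkin2013_Steps34` taken there is MIS-RENDERED (its binders `[Algebra k̄ K₁]
[IsScalarTower k̄ K K₁]` leave the `k̄`-structure of `K₁` free; see
`InseparableLocalUniformizationEngineTower.lean`, which vendors the corrected, weaker
`Temkin2013_Steps34_tower` and proves `Temkin2013_Steps34 → Temkin2013_Steps34_tower`). §4.2 only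
USES the corrected specialisation (Step 2 applies Steps 3–4 with `K₁ = K`,
`relConclusion_of_normalForm_nft_tower`), so the induction goes through VERBATIM with the weaker
hypothesis. This file records that and moves the frontier of the packaged §4.2 fact
`Temkin2013HeightStepOfDescent` (`InseparableLocalUniformizationDescent.lean`) to the corrected
fact:

* `relHeightLE_succ_nft_of_matsumura_tower`, `relHeightLE_succ_nft_tower` — PROVED: the induction
  step (proof text = that of `relHeightLE_succ_nft_of_matsumura`, hypothesis weakened; Matsumura
  26.9 discharged by `Matsumura1987_26_9_holds`).
* `Temkin2013HeightStepOfDescent.of_lemma332nft_steps34tower :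
    Temkin2013_Lemma332_nft → Temkin2013_Steps34_tower → Temkin2013HeightStepOfDescent` — PROVED:
  the frontier of the packaged §4.2 fact is `{Temkin2013_Lemma332_nft (Lemma 3.3.2,
  Berkovich-analytic decompletion), Temkin2013_Steps34_tower (Steps 3–4 of the proof of
  Thm. 4.1.1, being proved in the companion files from Lemmas 2.8.4/2.8.5,
  `Temkin2013_valuationRingOpen` and descent of smoothness over a field, all discharged)}`.
* `Temkin2013HeightStep.of_descent_lemma332nft_steps34tower`, `Temkin2013Relative.of_descent_nft_tower`,
  and the five-fact frontier in corrected renderings throughout: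
  `Temkin2013Relative.of_frontier₅_tower`, `Temkin2013.of_frontier₅_tower`,
  `Temkin2013HeightStep.of_frontier₅_tower`, `Temkin2013HeightStepOfDescent.of_frontier_tower` —
  `{Temkin2013Abhyankar, Temkin2013CurveSmoothing, Temkin2013RelativeCurveSmoothFibre,
  Temkin2013_Lemma332_nft, Temkin2013_Steps34_tower}` (via `Temkin2013Descent.of_frontier₃_tower`,
  `InseparableLocalUniformizationDefectStepTower.lean`).

## Sources

* M. Temkin, *Inseparable local uniformization*, arXiv:0804.1554v3, §4.2, Steps 0–2 (pp. 50–51);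
  proof of Thm. 4.1.1 (pp. 47–50); Thm. 3.3.1, Lemma 3.3.2 (pp. 44–46); Thm. 5.5.2 (p. 60).
* H. Matsumura, *Commutative Ring Theory*, Thm. 26.9.
-/

noncomputable section

open IsLocalRing

namespace Literature.AlgebraicGeometry.Resolution

universe u

section heightStep

variable {k : Type u} [Field k]

set_option maxHeartbeats 1600000 in
/-- **The induction step on the height** (Temkin 2013, §4.2, pp. 50–51), PROVED from the descent
theorem (`Temkin2013Descent` = Thm. 4.1.1), Lemma 3.3.2 in its corrected rendering
(`Temkin2013_Lemma332_nft`, `InseparableLocalUniformizationDecompletion.lean`), Steps 3–4 of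
the proof of Thm. 4.1.1 in their CORRECTED rendering (`Temkin2013_Steps34_tower`), and Matsumura 26.9 (`Matsumura1987_26_9`, the
dictionary "simple = separable residue field = `0`-smooth"; discharged, see
`relHeightLE_succ_nft_tower`): if the corrected relative
Thm. 1.3.2 holds for valuation rings of height `≤ n`, it holds in height `≤ n + 1` (for every
`n`; the paper needs `n ≥ 1`, the case `n = 0` being covered by Thm. 4.1.1 directly).
Step 1 (reduction to the normal form of `relConclusion_of_normalForm`): choose the immediate
coarsening `F° = O₁` of `K° = O` (`exists_minimal_overring`), of height `≤ n`
(`ringKrullDim_le_of_lt`); the subfield `k̄ = k(b) ⊆ F°` with `F̃/k̄` algebraic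
(`exists_intermediateField_valuation_eq_one_isResiduallyAlgebraicOver`); an affine model `Y` of
`k̄°` and a normal refinement of `X` over it; apply the induction hypothesis to the `k̄`-variety
`X_η` and the valued field `F` of height `≤ n`; extend the resulting refinement of `X_η` to a
refinement of `X` (`exists_refinement_adjoin_eq`) and pass to `L`, `Nr_L(X)` (Step 0); then
Step 2 (`relConclusion_of_normalForm`) and the Step-0 transports
(`Temkin2013RelConclusion.of_purelyInseparable_right`, `.of_le`) conclude.
[cite: Temkin2013, Section 4.2 (arXiv:0804.1554v3 pp. 50–51)] -/
theorem relHeightLE_succ_nft_of_matsumura_tower (h332 : Temkin2013_Lemma332_nft.{u})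
    (h34 : Temkin2013_Steps34_tower.{u}) (h269 : Matsumura1987_26_9.{u}) (hD : Temkin2013Descent.{u})
    (n : ℕ) (IH : Temkin2013RelHeightLE.{u} n) : Temkin2013RelHeightLE.{u} (n + 1) := by
  intro k K _ _ _ hfg O hk hdim A hAO hAfg hAfr
  classical
  by_cases hle : ringKrullDim O ≤ n
  · exact IH k K hfg O hk hle A hAO hAfg hAfr
  -- `K°` has height exactly `n + 1 ≥ 2`; its immediate coarsening `F°`
  have hO : O ≠ ⊤ := valuationSubring_ne_top_of_not_ringKrullDim_le O n hle
  haveI := hAfr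
  haveI : Finite {S : ValuationSubring K // O ≤ S} := finite_overrings_of_fg O hk A hAfg
  obtain ⟨O₁, hlt, -, himm⟩ := exists_minimal_overring O hO
  have hdim' : ringKrullDim O ≤ (n + 1 : ℕ) := by exact_mod_cast hdim
  have hdimO₁ : ringKrullDim O₁ ≤ n := ringKrullDim_le_of_lt O O₁ hlt n hdim'
  have hk₁ : ∀ c : k, algebraMap k K c ∈ O₁ := fun c => hlt.le (hk c)
  -- the subfield `k̄ = k(b) ⊆ F°` with `F̃/k̄` algebraic
  obtain ⟨f, b, -, -, hkbFG, -, -, hkbO₁, hres⟩ :=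
    exists_intermediateField_valuation_eq_one_isResiduallyAlgebraicOver k O₁ hk₁
      (trdeg_lt_aleph0_of_fg hfg)
  set kb : IntermediateField k K := IntermediateField.adjoin k (Set.range fun i => (b i : K))
    with hkbdef
  have hkb : ∀ c : kb, (c : K) ∈ O₁ := fun c => hkbO₁ c c.2
  have hkbfg : (⊤ : IntermediateField k kb).FG := intermediateField_fg_top_of_fg kb hkbFG
  have hkbK : (⊤ : IntermediateField kb K).FG := intermediateField_fg_top_of_fg_top kb hfg
  set Okb : ValuationSubring kb := O.comap (algebraMap kb K) with hOkbdef
  have hkOkb : ∀ c : k, algebraMap k kb c ∈ Okb := fun c => by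
    change algebraMap kb K (algebraMap k kb c) ∈ O
    rw [← IsScalarTower.algebraMap_apply]; exact hk c
  have hres' : IsResiduallyAlgebraicOver O₁ (algebraMap kb K).fieldRange ⊤ := by
    rw [fieldRange_algebraMap_intermediateField]; exact hres
  have hdim1 : ringKrullDim Okb = 1 :=
    ringKrullDim_comap_eq_one O O₁ hlt.le (algebraMap kb K) hkb hlt.ne himm hres'
  -- an affine model `Y = Spec B₀` of `k̄°` and a normal refinement of `X` over it
  obtain ⟨B₀, hB₀O, hB₀fg, hB₀fr⟩ := exists_affineModel k kb hkbfg Okb hkOkb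
  obtain ⟨tB, htB⟩ := hB₀fg
  obtain ⟨tA, htA⟩ := hAfg
  let Oalg : Subalgebra k K := { O.toSubring.toSubsemiring with algebraMap_mem' := hk }
  set A₀ : Subalgebra k K := Algebra.adjoin k (↑tA ∪ (algebraMap kb K) '' ↑tB) with hA₀def
  have hAA₀ : A ≤ A₀ := by rw [← htA]; exact Algebra.adjoin_mono Set.subset_union_left
  have hA₀fg : A₀.FG := ⟨tA ∪ tB.image (algebraMap kb K), by
    rw [Finset.coe_union, Finset.coe_image]⟩
  have htAO : (tA : Set K) ⊆ O := fun y hy => hAO (htA ▸ Algebra.subset_adjoin hy :)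
  have htBO : (algebraMap kb K) '' (tB : Set kb) ⊆ (O : Set K) := by
    rintro _ ⟨c, hc, rfl⟩
    exact hB₀O (htB ▸ Algebra.subset_adjoin hc :)
  have hA₀O : A₀.toSubring ≤ O.toSubring := by
    have : A₀ ≤ Oalg := Algebra.adjoin_le (Set.union_subset htAO htBO)
    exact fun y hy => this hy
  have hA₀fr : IsFractionRing A₀ K := by
    refine IsFractionRing.of_field A₀ K fun z => ?_
    obtain ⟨a, c, -, rfl⟩ := IsFractionRing.div_surjective (A := A) z
    exact ⟨⟨a, hAA₀ a.2⟩, ⟨c, hAA₀ c.2⟩, rfl⟩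
  obtain ⟨A₁, hA₀A₁, hA₁O, hA₁fg, hA₁fr, hA₁n, -⟩ := exists_normal_affineModel_ge' O A₀ hA₀O hA₀fg hA₀fr
  have hAA₁ : A ≤ A₁ := hAA₀.trans hA₀A₁
  have hB₀A₁ : ∀ c : B₀, algebraMap kb K c ∈ A₁ := fun c => by
    have hc : (c : kb) ∈ Algebra.adjoin k (tB : Set kb) := by rw [htB]; exact c.2
    have : Algebra.adjoin k (tB : Set kb) ≤ A₁.comap (IsScalarTower.toAlgHom k kb K) :=
      Algebra.adjoin_le fun y hy => hA₀A₁ (Algebra.subset_adjoin (Or.inr ⟨y, hy, rfl⟩))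
    exact this hc
  -- the generic fibre `X_η = Spec k̄[A₁]` and the induction hypothesis for `F`
  set Aη : Subalgebra kb K := Algebra.adjoin kb (A₁ : Set K) with hAηdef
  have hAη : Aη.toSubring ≤ O₁.toSubring :=
    adjoin_toSubring_le_valuationSubring kb O₁ hkb _ fun y hy => hlt.le (hA₁O hy)
  obtain ⟨hAηfg, hAηfr⟩ := adjoin_fg_and_isFractionRing kb A₁ hA₁fg hA₁fr
  obtain ⟨L, iF, iKL, ikbL, iT, hLfin, hLpi, l, hlfin, hlpi, Aη', hAηAη', hAη'O₁, hAη'fg, hAη'fr,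
    OL₁, hOL₁, Nη, hNη, hNηint, hNηfg, hNηfr, hsm, hsep, hreg⟩ :=
    IH kb K hkbK O₁ hkb hdimO₁ Aη hAη hAηfg hAηfr
  -- the `k̄`-structure on `L` provided by the induction hypothesis is the canonical one
  have hikbL : ikbL = (IntermediateField.instAlgebraSubtypeMem kb : Algebra kb L) :=
    Algebra.algebra_ext _ _ fun c => @IsScalarTower.algebraMap_apply kb K L _ _ _ _ _ ikbL iT c
  subst hikbL
  -- ground-field structure on `L`, the valuation ring `L° = OL` over `K°`, the coarsening `OL₁`
  letI ikL : Algebra k L := ((algebraMap K L).comp (algebraMap k K)).toAlgebra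
  haveI : IsScalarTower k K L := IsScalarTower.of_algebraMap_eq fun _ => rfl
  haveI : IsScalarTower k kb L := IsScalarTower.of_algebraMap_eq fun c => by
    change algebraMap K L (algebraMap k K c) = algebraMap K L ((algebraMap k kb c : kb) : K)
    rw [IsScalarTower.algebraMap_apply k kb K]
    rfl
  haveI := hLfin
  haveI := hLpi
  obtain ⟨OL, hOL⟩ := exists_valuationSubring_comap_eq (Ω := L) O
  have hOLle : OL ≤ OL₁ :=
    valuationSubring_le_of_comap_le_of_isPurelyInseparable (K := K) (by rw [hOL, hOL₁]; exact hlt.le)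
  have hOLne : OL ≠ OL₁ := fun heq => hlt.ne (by rw [← hOL, ← hOL₁, heq])
  have hkL : ∀ c : k, algebraMap k L c ∈ OL := fun c => by
    have : algebraMap k K c ∈ OL.comap (algebraMap K L) := by rw [hOL]; exact hk c
    exact this
  have hdimL : ringKrullDim OL ≤ n + 1 := by
    rw [ringKrullDim_eq_comap_of_isPurelyInseparable (K := K) OL, hOL]; exact hdim
  have hfgL : (⊤ : IntermediateField k L).FG := by
    haveI : Algebra.EssFiniteType k K := IntermediateField.fg_top_iff.mp hfg
    haveI : Algebra.EssFiniteType K L := inferInstance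
    haveI : Algebra.EssFiniteType k L := Algebra.EssFiniteType.comp k K L
    exact IntermediateField.fg_top_iff.mpr ‹_›
  -- the new base field `l ⊇ k̄` over `k` and its valuation ring `l° = L° ∩ l` of height one
  haveI : Algebra.EssFiniteType k kb := IntermediateField.fg_top_iff.mp hkbfg
  haveI : Module.Finite kb l := hlfin
  have hlfgk : (⊤ : IntermediateField k (l.restrictScalars k)).FG := by
    haveI : Algebra.EssFiniteType kb l := inferInstance
    haveI h3 : Algebra.EssFiniteType k l := Algebra.EssFiniteType.comp k kb l
    exact IntermediateField.fg_top_iff.mpr h3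
  set Ol : ValuationSubring l := OL.comap (algebraMap l L) with hOldef
  have hOlcomap : Ol.comap (algebraMap kb l) = Okb := by
    ext c
    change algebraMap l L (algebraMap kb l c) ∈ OL ↔ algebraMap kb K c ∈ O
    rw [← IsScalarTower.algebraMap_apply kb l L, IsScalarTower.algebraMap_apply kb K L,
      ← ValuationSubring.mem_comap, hOL]
  have hdim1l : ringKrullDim Ol = 1 := by
    haveI : IsPurelyInseparable kb l := hlpi
    rw [ringKrullDim_eq_comap_of_isPurelyInseparable (K := kb) Ol, hOlcomap, hdim1]
  -- `A₂`: a refinement of `X` with generic fibre `A′_η` (Step 1, "extended to a refinement of X")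
  obtain ⟨A₂, hA₁A₂, hA₂O, hA₂fg, hadj₂⟩ :=
    exists_refinement_adjoin_eq O O₁ hlt.le hk kb hres A₁ hA₁O hA₁fg Aη' hAη'O₁ hAη'fg hAηAη'
  have hAA₂ : A ≤ A₂ := hAA₁.trans hA₁A₂
  have hA₂fr : IsFractionRing A₂ K := by
    refine IsFractionRing.of_field A₂ K fun z => ?_
    obtain ⟨a, c, -, rfl⟩ := IsFractionRing.div_surjective (A := A) z
    exact ⟨⟨a, hAA₂ a.2⟩, ⟨c, hAA₂ c.2⟩, rfl⟩
  have hB₀A₂ : ∀ c : B₀, algebraMap kb K c ∈ A₂ := fun c => hA₁A₂ (hB₀A₁ c)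
  -- `A′ = Nr_L(A₂)` and `B′ = Nr_l(B₀)` ("replace `k̄, K, X` and `Y` with `l, L, Nr_L(X)` and `Nr_l(Y)`")
  have hA₂OL : ∀ a : A₂, algebraMap K L a ∈ OL := fun a => by
    have : (a : K) ∈ OL.comap (algebraMap K L) := by rw [hOL]; exact hA₂O a.2
    exact this
  obtain ⟨A', hA'fg, hA'fr, hA'O, hmemA', hA'n⟩ :=
    exists_integralClosure_model (k := k) OL A₂ hA₂OL hA₂fg hA₂fr
  have hB₀Ol : ∀ b : B₀, algebraMap kb l b ∈ Ol := fun b => by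
    change algebraMap l L (algebraMap kb l b) ∈ OL
    rw [← IsScalarTower.algebraMap_apply kb l L, IsScalarTower.algebraMap_apply kb K L]
    have : algebraMap kb K b ∈ OL.comap (algebraMap K L) := by
      rw [hOL]; exact hB₀O b.2
    exact this
  obtain ⟨B', hB'fg, hB'fr, hB'O, hmemB', -⟩ :=
    exists_integralClosure_model (k := k) Ol B₀ hB₀Ol ⟨tB, htB⟩ hB₀fr
  -- `B′ ⊆ A′`
  have hB'A' : ∀ b : B', algebraMap l L b ∈ A' := fun b => by
    rw [hmemA']
    have hb : IsIntegral B₀ (b : l) := (hmemB' _).mp b.2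
    have hb' : IsIntegral B₀ (algebraMap l L b) := hb.map (IsScalarTower.toAlgHom B₀ l L)
    -- `B₀ → A₂ → L`
    letI : Algebra B₀ A₂ := ((algebraMap kb K).comp (algebraMap B₀ kb)).codRestrict A₂
      (fun c => hB₀A₂ c) |>.toAlgebra
    haveI : IsScalarTower B₀ A₂ L := IsScalarTower.of_algebraMap_eq fun c => by
      change algebraMap kb L (c : kb) = algebraMap K L (algebraMap kb K (c : kb))
      exact IsScalarTower.algebraMap_apply kb K L _
    exact hb'.tower_top
  -- the generic fibre of `Nr_L(A₂)` over `l` is `N_η = Nr_L(A′_η)` (Step 1, last sentence)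
  have hB₀' : ∀ z : kb, ∃ a ∈ B₀.toSubring, ∃ c ∈ B₀.toSubring, z = a / c := fun z => by
    obtain ⟨a, c, -, rfl⟩ := IsFractionRing.div_surjective (A := B₀) z
    exact ⟨a, a.2, c, c.2, rfl⟩
  have hB₀A₂' : B₀.toSubring.map (algebraMap kb K) ≤ A₂.toSubring := by
    rintro _ ⟨c, hc, rfl⟩; exact hB₀A₂ ⟨c, hc⟩
  have hNηeq : Algebra.adjoin l (A' : Set L) = Nη := by
    refine le_antisymm (Algebra.adjoin_le fun y hy => ?_) fun y hy => ?_
    · -- `A′ ⊆ N_η`: integral over `A₂`, hence over `A′_η ⊇ A₂`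
      change y ∈ (Nη : Set L)
      rw [hNηint]
      change IsIntegral (Aη'.map (IsScalarTower.toAlgHom kb K L)) y
      rw [isIntegral_map_iff]
      have hy' : IsIntegral A₂ y := (hmemA' y).mp hy
      letI : Algebra A₂ Aη' := (A₂.val.toRingHom.codRestrict Aη'.toSubring fun a => by
        rw [← hadj₂]; exact Algebra.subset_adjoin a.2).toAlgebra
      haveI : IsScalarTower A₂ Aη' L := IsScalarTower.of_algebraMap_eq fun _ => rfl
      exact hy'.tower_top
    · -- `N_η ⊆ l[A′]`: `y` integral over `k̄[A₂]`, so `b y ∈ Nr_L(A₂)` for some `0 ≠ b ∈ B₀`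
      have hy' : IsIntegral ((Algebra.adjoin kb (A₂ : Set K)).map (IsScalarTower.toAlgHom kb K L)) y := by
        rw [hadj₂]
        have : y ∈ (Nη : Set L) := hy
        rw [hNηint] at this
        exact this
      obtain ⟨b, hb, hb0, hby⟩ :=
        exists_mul_isIntegral_of_isIntegral_map_adjoin B₀.toSubring hB₀' A₂.toSubring hB₀A₂' hy'
      have hbyA' : algebraMap kb L b * y ∈ A' := by
        rw [hmemA', ← isIntegral_subringMap_iff (k := k)]
        exact hby
      have hbl : algebraMap kb L b = algebraMap l L (algebraMap kb l b) :=
        IsScalarTower.algebraMap_apply kb l L b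
      have hc0 : algebraMap l L (algebraMap kb l b) ≠ 0 := by
        rw [← hbl]; exact (map_ne_zero _).mpr hb0
      have : y = algebraMap l L (algebraMap kb l b)⁻¹ * (algebraMap kb L b * y) := by
        rw [hbl, map_inv₀, ← mul_assoc, inv_mul_cancel₀ hc0, one_mul]
      rw [this]
      exact Subalgebra.mul_mem _ (Subalgebra.algebraMap_mem _ _) (Algebra.subset_adjoin hbyA')
  subst hNηeq
  -- `k(𝔭)` is integral over `l` (closedness of the centre in the new configuration)
  have hresL : IsResiduallyAlgebraicOver OL₁ (kb.toSubfield.map (algebraMap K L)) ⊤ :=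
    isResiduallyAlgebraicOver_of_isPurelyInseparable O₁ OL₁ hOL₁ kb.toSubfield hres
  have hkbl : kb.toSubfield.map (algebraMap K L) ≤ (l.restrictScalars k).toSubfield := by
    rintro _ ⟨c, hc, rfl⟩
    have : algebraMap kb L ⟨c, hc⟩ ∈ l := l.algebraMap_mem ⟨c, hc⟩
    exact this
  have hresl : IsResiduallyAlgebraicOver OL₁ (l.restrictScalars k).toSubfield ⊤ := fun r hr =>
    isAlgebraic_of_subfield_le (resField_mono OL₁ hkbl) (hresL r hr)
  have hkbOL₁ : ∀ c : kb, algebraMap kb L c ∈ OL₁ := fun c => by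
    have : algebraMap kb K c ∈ OL₁.comap (algebraMap K L) := by rw [hOL₁]; exact hkb c
    rw [IsScalarTower.algebraMap_apply kb K L]; exact this
  have hlOL₁ : ∀ c : (l.restrictScalars k), (c : L) ∈ OL₁ := fun c => by
    have hc : (c : L) ∈ l := c.2
    haveI : Algebra.IsIntegral kb l := Algebra.IsIntegral.of_finite kb l
    have hint : IsIntegral kb (⟨(c : L), hc⟩ : l) := Algebra.IsIntegral.isIntegral _
    have hint' : IsIntegral kb (c : L) := hint.map (IsScalarTower.toAlgHom kb l L)
    letI : Algebra kb OL₁ := ((algebraMap kb L).codRestrict OL₁ hkbOL₁).toAlgebra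
    haveI : IsScalarTower kb OL₁ L := IsScalarTower.of_algebraMap_eq fun _ => rfl
    have h2 : IsIntegral OL₁ (c : L) := hint'.tower_top
    obtain ⟨w, hw⟩ := IsIntegrallyClosed.algebraMap_eq_of_integral h2
    rw [← hw]; exact w.2
  -- switch to `l` viewed as an intermediate field of `L/k`
  set kb' : IntermediateField k L := l.restrictScalars k with hkb'def
  have hNη' : (Algebra.adjoin kb' (A' : Set L)).toSubring ≤ OL₁.toSubring := hNη
  have hint' : Algebra.IsIntegral kb'
      (↥(Algebra.adjoin kb' (A' : Set L)) ⧸ centreIdeal (Algebra.adjoin kb' (A' : Set L)) OL₁ hNη') :=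
    algebra_isIntegral_quot_centreIdeal OL₁ kb' (Algebra.adjoin kb' (A' : Set L)) hNη' hlOL₁ hresl
  have hsm' : Algebra.IsSmoothAt kb' (centreIdeal (Algebra.adjoin kb' (A' : Set L)) OL₁ hNη') := hsm
  -- simplicity: `k(𝔭)/l` is algebraic and `0`-smooth, hence separable (Matsumura 26.9)
  set N' : Subalgebra kb' L := Algebra.adjoin kb' (A' : Set L) with hN'def
  set 𝔭 : Ideal N' := centreIdeal N' OL₁ hNη' with h𝔭def
  haveI : Algebra.IsIntegral kb' (N' ⧸ 𝔭) := hint'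
  haveI h𝔭max : 𝔭.IsMaximal := Ideal.Quotient.maximal_of_isField _
    (isField_of_isIntegral_of_isField' (R := kb') (S := N' ⧸ 𝔭) (Field.toIsField kb'))
  letI : Field (N' ⧸ 𝔭) := Ideal.Quotient.field 𝔭
  have hsep' : Algebra.IsSeparable kb' (N' ⧸ 𝔭) := by
    let Rp := Localization.AtPrime 𝔭
    let e₀ : N' ⧸ 𝔭 ≃+* ResidueField Rp := IsLocalization.AtPrime.equivQuotMaximalIdeal 𝔭 Rp
    have he₀ : ∀ c : kb', e₀ (algebraMap kb' (N' ⧸ 𝔭) c) = algebraMap kb' (ResidueField Rp) c := by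
      intro c
      change IsLocalization.AtPrime.equivQuotMaximalIdeal 𝔭 Rp
        (Ideal.Quotient.mk 𝔭 (algebraMap kb' N' c)) = _
      rw [IsLocalization.AtPrime.equivQuotMaximalIdeal_apply_mk]
      change Ideal.Quotient.mk _ (algebraMap N' Rp (algebraMap kb' N' c)) =
        IsLocalRing.residue Rp (algebraMap kb' Rp c)
      rw [IsScalarTower.algebraMap_apply kb' N' Rp]
      rfl
    let e : (N' ⧸ 𝔭) ≃ₐ[kb'] ResidueField Rp := AlgEquiv.ofRingEquiv (f := e₀) he₀
    haveI : Algebra.IsAlgebraic kb' (N' ⧸ 𝔭) := Algebra.IsIntegral.isAlgebraic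
    haveI : Algebra.IsAlgebraic kb' (ResidueField Rp) := e.isAlgebraic_iff.mp ‹_›
    have hsm0 : Algebra.FormallySmooth kb' (ResidueField Rp) := hsep
    haveI : Algebra.IsSeparable kb' (ResidueField Rp) := (h269 kb' (ResidueField Rp) ‹_›).mp hsm0
    exact AlgEquiv.Algebra.isSeparable e.symm
  -- Step 2 in the new configuration, and the Step-0 transports back to `(k, K, K°, X)`
  let B'' : Subalgebra k kb' := B'
  have hB'O' : B''.toSubring ≤ (OL.comap (algebraMap kb' L)).toSubring := hB'O
  have hB'fg' : B''.FG := hB'fg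
  have hB'fr' : IsFractionRing B'' kb' := hB'fr
  have hB'A'' : ∀ b : B'', algebraMap kb' L b ∈ A' := hB'A'
  have hdim1' : ringKrullDim (OL.comap (algebraMap kb' L)) = 1 := hdim1l
  have hconclL : Temkin2013RelConclusion k L OL A' :=
    relConclusion_of_normalForm_nft_tower h332 h34 hD hfgL OL hkL OL₁ hOLle kb' hlfgk hdim1' B'' hB'O'
      hB'fg' hB'fr' A' hA'O hA'fg hA'fr hA'n hB'A'' hNη' hint' hsm' hsep'
  have hA₂A'' : ∀ a ∈ A₂, algebraMap K L a ∈ A' := fun a ha =>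
    (hmemA' _).mpr (isIntegral_algebraMap (R := A₂) (x := ⟨a, ha⟩))
  have hconclK : Temkin2013RelConclusion k K O A₂ :=
    Temkin2013RelConclusion.of_purelyInseparable_right O A₂ hA₂fg hA₂fr L OL hOL A' hA₂A'' hconclL
  exact Temkin2013RelConclusion.of_le O hAA₂ hconclK

/-- **The induction step on the height from the corrected Lemma 3.3.2 and the corrected
Steps 3–4** (Temkin 2013, §4.2), with Matsumura's Thm. 26.9 discharged
(`Matsumura1987_26_9_holds`). [cite: Temkin2013, Section 4.2 (arXiv:0804.1554v3 pp. 50–51)] -/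
theorem relHeightLE_succ_nft_tower (h332 : Temkin2013_Lemma332_nft.{u})
    (h34 : Temkin2013_Steps34_tower.{u}) (hD : Temkin2013Descent.{u}) (n : ℕ)
    (IH : Temkin2013RelHeightLE.{u} n) : Temkin2013RelHeightLE.{u} (n + 1) :=
  relHeightLE_succ_nft_of_matsumura_tower h332 h34 Matsumura1987_26_9_holds hD n IH

end heightStep

/-! ### The frontier of `Temkin2013HeightStepOfDescent` in corrected renderings -/

/-- **`Temkin2013HeightStepOfDescent` from its printed inputs, corrected renderings**: §4.2 of
Temkin 2013 (the induction step on the height, with the descent Thm. 4.1.1 as hypothesis) follows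
from Lemma 3.3.2 (`Temkin2013_Lemma332_nft`) and Steps 3–4 of the proof of Thm. 4.1.1
(`Temkin2013_Steps34_tower`); Steps 0–2 of §4.2 and Matsumura 26.9 are proved in the tree.
This is the frontier of the packaged fact: `{Temkin2013_Lemma332_nft, Temkin2013_Steps34_tower}`.
[cite: Temkin2013, Section 4.2 (arXiv:0804.1554v3 pp. 50–51)] -/
theorem Temkin2013HeightStepOfDescent.of_lemma332nft_steps34tower
    (h332 : Temkin2013_Lemma332_nft.{u}) (h34 : Temkin2013_Steps34_tower.{u}) :
    Temkin2013HeightStepOfDescent.{u} :=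
  fun hD n _ IH => relHeightLE_succ_nft_tower h332 h34 hD n IH

/-- The tree's named fact `Temkin2013HeightStep` (§4.2 without the descent input) from the
descent theorem, the corrected Lemma 3.3.2 and the corrected Steps 3–4.
[cite: Temkin2013, Section 4.2 (arXiv:0804.1554v3 pp. 50–51)] -/
theorem Temkin2013HeightStep.of_descent_lemma332nft_steps34tower (hD : Temkin2013Descent.{u})
    (h332 : Temkin2013_Lemma332_nft.{u}) (h34 : Temkin2013_Steps34_tower.{u}) :
    Temkin2013HeightStep.{u} :=
  fun n _ IH => relHeightLE_succ_nft_tower h332 h34 hD n IH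

/-- **The corrected relative Thm. 1.3.2 from the descent theorem, the corrected Lemma 3.3.2 and
the corrected Steps 3–4** (frontier `{Temkin2013Descent, Temkin2013_Lemma332_nft,
Temkin2013_Steps34_tower}`; induction on the height with base `Temkin2013RelHeightLE.zero_holds`,
`Temkin2013Relative.of_frontier`). [cite: Temkin2013, Thm. 1.3.2 via Section 4] -/
theorem Temkin2013Relative.of_descent_nft_tower (hD : Temkin2013Descent.{u})
    (h332 : Temkin2013_Lemma332_nft.{u}) (h34 : Temkin2013_Steps34_tower.{u}) :
    Temkin2013Relative.{u} :=
  Temkin2013Relative.of_frontier hD (Temkin2013HeightStepOfDescent.of_lemma332nft_steps34tower h332 h34)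

/-- **The corrected relative Thm. 1.3.2 from the five-fact frontier, corrected renderings
throughout**: Thm. 5.5.2 (i) (`Temkin2013Abhyankar`), the curve-smoothing lemma
(`Temkin2013CurveSmoothing`), Thm. 3.3.1 for smooth generic fibres
(`Temkin2013RelativeCurveSmoothFibre`), Lemma 3.3.2 (`Temkin2013_Lemma332_nft`) and Steps 3–4 of
the proof of Thm. 4.1.1 (`Temkin2013_Steps34_tower`); all printed layers in between are proved in
the tree (`Temkin2013Descent.of_frontier₃_tower`, `relHeightLE_succ_nft_tower`).
[cite: Temkin2013, Thm. 1.3.2 via Sections 3.3, 4.1, 4.2, 5.5] -/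
theorem Temkin2013Relative.of_frontier₅_tower (hA : Temkin2013Abhyankar.{u})
    (hcs : Temkin2013CurveSmoothing.{u}) (hsf : Temkin2013RelativeCurveSmoothFibre.{u})
    (h332 : Temkin2013_Lemma332_nft.{u}) (h34 : Temkin2013_Steps34_tower.{u}) :
    Temkin2013Relative.{u} :=
  Temkin2013Relative.of_descent_nft_tower (Temkin2013Descent.of_frontier₃_tower hA hcs hsf h34)
    h332 h34

/-- **`Temkin2013` (the weak absolute Thm. 1.3.2 used by the routes) from the five-fact frontier
in corrected renderings** `{Temkin2013Abhyankar, Temkin2013CurveSmoothing,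
Temkin2013RelativeCurveSmoothFibre, Temkin2013_Lemma332_nft, Temkin2013_Steps34_tower}`.
[cite: Temkin2013, Thm. 1.3.2] -/
theorem Temkin2013.of_frontier₅_tower (hA : Temkin2013Abhyankar.{u})
    (hcs : Temkin2013CurveSmoothing.{u}) (hsf : Temkin2013RelativeCurveSmoothFibre.{u})
    (h332 : Temkin2013_Lemma332_nft.{u}) (h34 : Temkin2013_Steps34_tower.{u}) : Temkin2013.{u} :=
  (Temkin2013Relative.of_frontier₅_tower hA hcs hsf h332 h34).temkin2013

/-- **The induction step on the height (`Temkin2013HeightStep`) from the five-fact frontier in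
corrected renderings.** [cite: Temkin2013, Section 4.2 (arXiv:0804.1554v3 pp. 50–51)] -/
theorem Temkin2013HeightStep.of_frontier₅_tower (hA : Temkin2013Abhyankar.{u})
    (hcs : Temkin2013CurveSmoothing.{u}) (hsf : Temkin2013RelativeCurveSmoothFibre.{u})
    (h332 : Temkin2013_Lemma332_nft.{u}) (h34 : Temkin2013_Steps34_tower.{u}) :
    Temkin2013HeightStep.{u} :=
  Temkin2013HeightStep.of_descent_lemma332nft_steps34tower
    (Temkin2013Descent.of_frontier₃_tower hA hcs hsf h34) h332 h34

end Literature.AlgebraicGeometry.Resolution
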